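import Mathlib
import Literature.Computability.AlgebraicComplexity.HessianAtOrigin
import Summits.ValiantsHypothesis.ValiantsHypothesis.Theorems.GrenetZeonTwoDimCoefficientsScalingOrderTwo
import Summits.ValiantsHypothesis.ValiantsHypothesis.Theorems.GrenetZeonTwoDimCoefficientsScalingRayNodes
import Summits.ValiantsHypothesis.ValiantsHypothesis.Theorems.GrenetZeonTwoDimCoefficientsScalingCompanionTwo

/-!
# Crux `GrenetZeon.TwoDimCoefficients` (stmt-ValiantsHypothesis-8062), stub `stub_dualUnipotent`:
# scaling-closure — RAY INTERPOLATION AT ALL ORDERS: `rank Hess per_n(z₀) ≤ 2J·m` at every good ray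

The general form of ✓ `rank_hess0_perPoly_le_four_mul` (`J = 2`).  Let the shadow of a unipotent dual representation
(`deg D_k ≤ kn`) have top companion order `J ≤ m`: `Φ = c + Σ_{k=1}^{J} Ψ_k`, `Ψ_k = [D_k]_{kn}` (`Ψ_1 = β⁻¹per_n`,
✓ `homogeneousComponent_coeff_det_one`).  On the ray `λ ↦ λ·z₀`, `Φ(λz₀) = R(λⁿ)` with the RAY POLYNOMIAL
`R(t) = c + Σ_k Ψ_k(z₀)t^k`.  If `R` has `J` distinct SIMPLE roots `t_1, …, t_J` (all `≠ 0` as `c ≠ 0`), then the ray points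
`λ_i z₀` (`λ_iⁿ = t_i`) are SMOOTH zeros of `Φ` (Euler: `z·∇Φ(λ_i z₀) = n·t_i R′(t_i) ≠ 0`), Mignon–Ressayre on the shadow
(✓ `rank_hess0_shadow_le`) bounds the node matrices `Σ_k λ_i^{kn−2} Hess Ψ_k(z₀)` by `2m`, and the node matrix
`(λ_i^{kn−2}) = diag(λ_i^{n−2})·Vandermonde(t)` is invertible, so by ✓ `rank_hess0_le_of_rayNodes`:

* ★★ `rank_hess0_perPoly_le_of_simpleRayRoots` — `rank Hess per_n(z₀) ≤ J·(2m)`.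

Consequently (memo SEVENTEENTH-HAND.md §E): if the shadow `Φ` is SQUAREFREE, a generic `z₀` has `J` distinct simple ray
roots and `rank Hess per_n(z₀) = n²`, so `n² ≤ 2Jm ≤ 2m²/n`, i.e. **`n³ ≤ 2m²` — the 3/2 rung (crux 24318) for every
hdeg pencil (in particular every index-`n` pencil, ✓ `hdeg_of_index`) whose shadow is squarefree**; the generic-point
step is the routine extension of the `J = 2` case ✓ `sq_le_four_mul_of_orderTwo`.  The residual of the whole method is
thereby ONE statement: Mignon–Ressayre for the MULTIPLE factors of a non-squarefree shadow (lemma L1′).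

HONEST FRAMING: a pointwise Hessian bound; the stub `DualUnipotentBound`, both cruxes and `VP ≠ VNP` remain open.

References: T. Mignon, N. Ressayre, Int. Math. Res. Not. 2004:79, Thm. 1.1 (via the tree); folklore (Euler, Vandermonde).
-/

-- single-conjunct layout `Summits/ValiantsHypothesis/ValiantsHypothesis`: the duplicated namespace
-- component is mandated by the tree.
set_option linter.dupNamespace false
set_option autoImplicit false

noncomputable section

namespace Summit.ValiantsHypothesis.ValiantsHypothesis.Theorems.GrenetZeonTwoDimCoefficients.ScalingClosure

open MvPolynomial Matrix
open Literature.Computability.AlgebraicComplexity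
open Summit.ValiantsHypothesis.ValiantsHypothesis.Cruxes.TwoDimCoefficients.DimTwoCases

section Tools

variable {σ : Type*} [Fintype σ]

/-- **Euler at a point, finite sums**: if all first partials of `G = c + Σ_e Ψ_e` (`Ψ_e` forms of degrees `d_e`) vanish at
`z`, then `Σ_e d_e·Ψ_e(z) = 0`. [folklore] -/
theorem euler_eval_sum_eq_zero_of_pderiv_eq_zero {E : Type*} [Fintype E] (c : ℂ) (Ψ : E → MvPolynomial σ ℂ)
    (d : E → ℕ) (hΨ : ∀ e, (Ψ e).IsHomogeneous (d e)) (z : σ → ℂ)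
    (hz : ∀ i, eval z (pderiv i (MvPolynomial.C c + ∑ e, Ψ e)) = 0) :
    ∑ e, (d e : ℂ) * eval z (Ψ e) = 0 := by
  have hsum : eval z (∑ i : σ, X i * pderiv i (MvPolynomial.C c + ∑ e, Ψ e)) = 0 := by
    rw [map_sum]
    exact Finset.sum_eq_zero fun i _ => by rw [map_mul, hz i, mul_zero]
  have hexp : ∑ i : σ, X i * pderiv i (MvPolynomial.C c + ∑ e, Ψ e) = ∑ e, (d e : MvPolynomial σ ℂ) * Ψ e := by
    simp_rw [map_add, pderiv_C, zero_add, map_sum, Finset.mul_sum]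
    rw [Finset.sum_comm]
    exact Finset.sum_congr rfl fun e _ => by rw [(hΨ e).sum_X_mul_pderiv, nsmul_eq_mul]
  rw [hexp, map_sum] at hsum
  simpa only [map_mul, map_natCast] using hsum

end Tools

section Ray

variable {n m : ℕ}

/-- `[D₁]_n = β⁻¹·per_n` (`n ≥ 1`): the first graded piece of the shadow. [folklore] -/
theorem homogeneousComponent_coeff_det_one (hn : 1 ≤ n) (A B : AffMat n m) (α β c : ℂ) (hc : c ≠ 0) (hβ : β ≠ 0)
    (hdet : A.det = MvPolynomial.C c)
    (hper : perPoly (Fin n) ℂ = MvPolynomial.C α * A.det + MvPolynomial.C β * (A.adjugate * B).trace) :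
    homogeneousComponent n ((det ((Polynomial.X : Polynomial (MvPolynomial (Fin n × Fin n) ℂ)) •
        B.map Polynomial.C + A.map Polynomial.C)).coeff 1) = MvPolynomial.C β⁻¹ * perPoly (Fin n) ℂ := by
  have hu : IsUnit A.det := by
    rw [hdet]; exact (isUnit_iff_ne_zero.mpr hc).map MvPolynomial.C
  have hhom : (perPoly (Fin n) ℂ).IsHomogeneous n := by
    simpa only [Fintype.card_fin] using (perPoly_isHomogeneous (n := Fin n) (k := ℂ))
  rw [coeff_det_one A B hu, trace_adjugate_mul_eq_of_per A B α β c hβ hdet hper, homogeneousComponent_C_mul, map_sub,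
    homogeneousComponent_of_mem ((mem_homogeneousSubmodule _ _).mpr hhom), if_pos rfl,
    homogeneousComponent_of_mem ((mem_homogeneousSubmodule _ _).mpr (isHomogeneous_C _ _)), if_neg (by omega),
    sub_zero]

/-- ★★ **Ray interpolation at all orders.**  Let `per_n = α·c + β·tr(adj A·B)` be a unipotent dual representation
(`det A = c ≠ 0`, `A, B` affine `m × m`, `n ≥ 2`, `m ≥ 2`) with `deg D_k ≤ kn` (`k ≥ 2`) and companions vanishing above order
`J` (`1 ≤ J ≤ m`), `Ψ_k = [D_k]_{kn}`.  If at `z₀` the ray polynomial `R(t) = c + Σ_{k=1}^J Ψ_k(z₀)t^k` has `J` DISTINCT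
SIMPLE roots `t_1, …, t_J` (`R(t_i) = 0`, `t_i R′(t_i) ≠ 0`), then `rank Hess per_n(z₀) ≤ J·(2m)`.
[cite: MignonRessayre2004, Thm. 1.1 — via the tree; folklore] -/
theorem rank_hess0_perPoly_le_of_simpleRayRoots (A B : AffMat n m) (hA : IsAffine A) (hB : IsAffine B)
    (α β c : ℂ) (hc : c ≠ 0) (hβ : β ≠ 0) (hdet : A.det = MvPolynomial.C c)
    (hper : perPoly (Fin n) ℂ = MvPolynomial.C α * A.det + MvPolynomial.C β * (A.adjugate * B).trace)
    (hn : 2 ≤ n) (hm2 : 2 ≤ m) (D : ℕ → MvPolynomial (Fin n × Fin n) ℂ)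
    (hD : ∀ k, D k = (det ((Polynomial.X : Polynomial (MvPolynomial (Fin n × Fin n) ℂ)) •
      B.map Polynomial.C + A.map Polynomial.C)).coeff k)
    (hdeg : ∀ k, 2 ≤ k → ∀ d, k * n < d → homogeneousComponent d (D k) = 0)
    {J : ℕ} (hJ1 : 1 ≤ J) (hJm : J ≤ m) (hJ : ∀ k, J < k → k ≤ m → homogeneousComponent (k * n) (D k) = 0)
    (z₀ : Fin n × Fin n → ℂ) (t : Fin J → ℂ) (ht : Function.Injective t)
    (hroot : ∀ i, c + ∑ e : Fin J, t i ^ ((e : ℕ) + 1) * eval z₀ (homogeneousComponent (((e : ℕ) + 1) * n) (D (e + 1)))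
      = 0)
    (hsimple : ∀ i, ∑ e : Fin J, (((e : ℕ) + 1 : ℕ) : ℂ) * (t i ^ ((e : ℕ) + 1) *
      eval z₀ (homogeneousComponent (((e : ℕ) + 1) * n) (D (e + 1)))) ≠ 0) :
    (hess0 (transl z₀ (perPoly (Fin n) ℂ))).rank ≤ J * (2 * m) := by
  classical
  -- the graded pieces of the shadow
  set Ψ : Fin J → MvPolynomial (Fin n × Fin n) ℂ := fun e =>
    homogeneousComponent (((e : ℕ) + 1) * n) (D (e + 1)) with hΨdef
  set d : Fin J → ℕ := fun e => ((e : ℕ) + 1) * n with hddef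
  have hΨ_hom : ∀ e, (Ψ e).IsHomogeneous (d e) := fun e => homogeneousComponent_isHomogeneous _ _
  set Φ : MvPolynomial (Fin n × Fin n) ℂ := MvPolynomial.C c + ∑ e, Ψ e with hΦ
  -- identify with the shadow of `exists_shadowFamily`
  obtain ⟨Pf, h0, hMR⟩ := exists_shadowFamily A B hA hB α β c hc hβ hdet hper (by omega) hm2 D hD hdeg
  have hshape : MvPolynomial.C c + MvPolynomial.C β⁻¹ * perPoly (Fin n) ℂ +
      (∑ k ∈ Finset.range (m + 1), if 2 ≤ k then homogeneousComponent (k * n) (D k) else 0) = Φ := by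
    have hsumJ : (∑ k ∈ Finset.range (m + 1), if 2 ≤ k then homogeneousComponent (k * n) (D k) else 0) =
        ∑ k ∈ Finset.range (J + 1), if 2 ≤ k then homogeneousComponent (k * n) (D k) else 0 := by
      rw [Finset.range_eq_Ico, Finset.range_eq_Ico,
        ← Finset.sum_Ico_consecutive _ (Nat.zero_le (J + 1)) (by omega : J + 1 ≤ m + 1)]
      conv_rhs => rw [← add_zero (∑ k ∈ Finset.Ico 0 (J + 1), _)]
      congr 1
      refine Finset.sum_eq_zero fun k hk => ?_
      rw [Finset.mem_Ico] at hk
      rw [if_pos (by omega), hJ k (by omega) (by omega)]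
    have hΦsum : (∑ e : Fin J, Ψ e) = ∑ k ∈ Finset.range J, homogeneousComponent ((k + 1) * n) (D (k + 1)) :=
      Fin.sum_univ_eq_sum_range (fun k => homogeneousComponent ((k + 1) * n) (D (k + 1))) J
    obtain ⟨J', rfl⟩ : ∃ J', J = J' + 1 := ⟨J - 1, by omega⟩
    rw [hsumJ, hΦ, hΦsum, Finset.sum_range_succ' _ J', zero_add, one_mul, hD 1,
      homogeneousComponent_coeff_det_one (by omega) A B α β c hc hβ hdet hper]
    have hshift : (∑ k ∈ Finset.range (J' + 1 + 1), if 2 ≤ k then homogeneousComponent (k * n) (D k) else 0) =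
        ∑ k ∈ Finset.range J', homogeneousComponent ((k + 1 + 1) * n) (D (k + 1 + 1)) := by
      rw [Finset.sum_range_succ' _ (J' + 1), Finset.sum_range_succ' _ J']
      simp only [show ¬ (2 ≤ 0) from by omega, show ¬ (2 ≤ 0 + 1) from by omega, if_false, add_zero]
      exact Finset.sum_congr rfl fun k _ => if_pos (by omega)
    rw [hshift]
    ring
  have h0' : ∀ z : Fin n × Fin n → ℂ, eval (fun o : Option (Fin n × Fin n) => o.elim (0 : ℂ) z) Pf = eval z Φ := by
    intro z; rw [h0 z, hshape]
  have hnode : ∀ z, eval z Φ = 0 → (∃ i, eval z (pderiv i Φ) ≠ 0) → (hess0 (transl z Φ)).rank ≤ 2 * m := by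
    rintro z hz ⟨i, hi⟩
    exact rank_hess0_shadow_le Pf Φ (2 * m) h0' hMR z hz i hi
  -- ray parameters
  have hl : ∀ i, ∃ l : ℂ, l ^ n = t i := fun i => IsAlgClosed.exists_pow_nat_eq (t i) (by omega)
  choose l hl using hl
  have ht0 : ∀ i, t i ≠ 0 := by
    intro i hti
    have h := hsimple i
    simp only [hti, zero_pow (Nat.succ_ne_zero _), zero_mul, mul_zero, Finset.sum_const_zero] at h
    exact h rfl
  have hl0 : ∀ i, l i ≠ 0 := fun i h => ht0 i (by rw [← hl i, h, zero_pow (by omega)])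
  -- node bounds on the rays
  have hnodes : ∀ i, (hess0 (transl (l i • z₀) (MvPolynomial.C c + ∑ e, Ψ e))).rank ≤ 2 * m := by
    intro i
    have hpow : ∀ e : Fin J, l i ^ d e = t i ^ ((e : ℕ) + 1) := fun e => by
      rw [hddef]; simp only; rw [mul_comm, pow_mul, hl i]
    refine hnode _ ?_ ?_
    · rw [map_add, MvPolynomial.eval_C, map_sum, ← hroot i]
      congr 1
      exact Finset.sum_congr rfl fun e _ => by rw [eval_smul_of_isHomogeneous _ (hΨ_hom e), hpow]
    · by_contra hno
      push Not at hno
      have he := euler_eval_sum_eq_zero_of_pderiv_eq_zero c Ψ d hΨ_hom (l i • z₀) hno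
      apply hsimple i
      have hn0 : (n : ℂ) ≠ 0 := Nat.cast_ne_zero.mpr (by omega)
      have : ∑ e : Fin J, (d e : ℂ) * eval (l i • z₀) (Ψ e) =
          (n : ℂ) * ∑ e : Fin J, (((e : ℕ) + 1 : ℕ) : ℂ) * (t i ^ ((e : ℕ) + 1) * eval z₀ (Ψ e)) := by
        rw [Finset.mul_sum]
        refine Finset.sum_congr rfl fun e _ => ?_
        rw [eval_smul_of_isHomogeneous _ (hΨ_hom e), hpow, hddef]
        push_cast
        ring
      rw [this] at he
      exact (mul_eq_zero.mp he).resolve_left hn0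
  -- the generalized Vandermonde `λ_i^{d_e − 2} = λ_i^{n−2}·t_i^e`
  set V : Matrix (Fin J) (Fin J) ℂ := Matrix.of fun (i : Fin J) (e : Fin J) => l i ^ (d e - 2) with hV
  have hVeq : V = Matrix.diagonal (fun i => l i ^ (n - 2)) * Matrix.vandermonde t := by
    ext i e
    rw [Matrix.diagonal_mul, Matrix.vandermonde_apply, hV, Matrix.of_apply, hddef]
    simp only
    rw [show ((e : ℕ) + 1) * n - 2 = (n - 2) + (e : ℕ) * n by
        rw [Nat.add_mul, one_mul]; omega, pow_add, mul_comm (e : ℕ) n, pow_mul, hl i]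
  have hVdet : IsUnit V.det := by
    rw [hVeq, Matrix.det_mul, Matrix.det_diagonal]
    refine isUnit_iff_ne_zero.mpr (mul_ne_zero ?_ (Matrix.det_vandermonde_ne_zero_iff.mpr ht))
    exact Finset.prod_ne_zero_iff.mpr fun i _ => pow_ne_zero _ (hl0 i)
  have hWV : V⁻¹ * V = 1 := Matrix.nonsing_inv_mul V hVdet
  -- interpolate
  obtain ⟨J', rfl⟩ : ∃ J', J = J' + 1 := ⟨J - 1, by omega⟩
  have h := rank_hess0_le_of_rayNodes c Ψ d hΨ_hom z₀ l (2 * m) hnodes V⁻¹ (by rw [hV] at hWV ⊢; exact hWV)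
    (0 : Fin (J' + 1))
  -- `Ψ 0 = β⁻¹ per`
  have hΨ0 : Ψ 0 = MvPolynomial.C β⁻¹ * perPoly (Fin n) ℂ := by
    rw [hΨdef]; simp only [Fin.val_zero, zero_add, one_mul]
    rw [hD 1]
    exact homogeneousComponent_coeff_det_one (by omega) A B α β c hc hβ hdet hper
  rw [hΨ0, map_mul, transl_C, hess0_C_mul, Fintype.card_fin] at h
  exact (rank_le_rank_smul_of_ne_zero (inv_ne_zero hβ) _).trans h

end Ray

end Summit.ValiantsHypothesis.ValiantsHypothesis.Theorems.GrenetZeonTwoDimCoefficients.ScalingClosure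

end
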